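import Literature.NumberTheory.LFunctions.Zhang2022.Section10Lemma102Tent
import Literature.NumberTheory.LFunctions.Zhang2022.Section10TruncationBridges
import Literature.NumberTheory.LFunctions.Zhang2022.Section10RemarkShift
import Literature.NumberTheory.LFunctions.Zhang2022.SkeletonReductions
import HarnessLib

/-!
# Zhang (2022), Remark p. 57 — the SHIFTED Lemma 10.2 («a result similar to Lemma 10.2») in
# RELATIVE form, from the shift-0 log-mean estimate (Lemma 8.4 at `β_μ = 0`)

Topic `Literature/NumberTheory/LFunctions/Zhang2022` (Landau–Siegel audit tree; verdict-neutral).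
Y. Zhang, *Discrete mean estimates and the Landau–Siegel zero*, arXiv:2211.02515v1 (2022)
[Zhang2022LandauSiegel], §10 Remark p. 57 (tex L2853–L2870: "with simple modification, Lemma 10.1
and 10.2 [apply] to the sums … with `f̃(log(drn)/log P + 0.004 − α̃)`") as used at §10 pp. 60–61
("By a result similar to Lemma 10.2 and the results in Section 8 …", the evaluation of
`S_j(𝐚₁₂,𝐚₁₄)`, DAG nodes Z22:§10.u055–u057) — **an unrefereed manuscript under adjudication;
nothing in this file asserts any claim of the manuscript.** ZHANG-L discharge lane (WP10, seat
zl-w10-p1; leaf `Typed.Sec10C.Gather1214`). Theorem-only: 0 definitions, 0 named facts.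

THE REDUCTION (kernel-checked here; the exact twin of sz-d43's `Section10Lemma102Steps` for the
shifted tent). Write `y* = drP^{0.004}/(Dt₀)` (`Typed.Sec10B.yShift`),
`A_{d,r}(X) = Σ_{n≤X} χ(n)ξ₀ⱼ(n;d,r)n⁻¹log(X/n)` and `R(d,r) = (∏_{q∣dr}(1 − q⁻¹)⁻¹)²`. Since
`f̃(log(drn)/log P + 0.004 − α̃) = f̃(log(y*·n)/log P)` (`Typed.Sec10B.shiftArg_eq`), the shifted sum
`frakv2S` of L3-t2 (`Typed.Sec10B.frakv2S`, node §10.u033) is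

  `frakv2S = (500/log P)(A(P^{0.504}/y*) − 2A(P^{0.502}/y*) + A(P^{0.5}/y*))`   (`frakv2S_eq_logMeans`),

and the hypothesis `hA` below — **Lemma 8.4 at shift `β_μ = 0`, relative form**, VERBATIM the
hypothesis of `Lemma102.eq108Rel_of_logMean` (so that one proof of it serves Lemma 10.2 and its
shifted twin alike): for `dr < PT⁻²`, `T ≤ x ≤ P`,
`‖A_{d,r}(x) − L′(1,χ)Π(d,r)(1 + (β_{j+1}+β_{j+2})log x + ½β_{j+1}β_{j+2}log²x)‖ ≤ C𝓛⁻⁶R(d,r)` —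
gives, by the residue combinations `resComb_three/two/one` at `y := y*`:

* pointwise forms at a fixed modulus (`frakv2S_low_of_key`, `frakv2S_mid_of_key`,
  `frakv2S_top_of_key`): the (10.8)/(10.9)/(10.10)-type evaluations of `frakv2S` with `y*` in the
  thresholds and in `𝔶₁ⱼ, 𝔶₂ⱼ`, error `≤ 2000E/log P` from a log-mean tolerance `E`;
* `eq108SRel_of_logMean` — `y* ≤ P^{0.5}/T`: `frakv2S = (L′(1,χ)Π(d,r)/500)β_{j+1}β_{j+2}log P + O(𝓛⁻¹⁵R)`;
* `eq109SRel_of_logMean` — `P^{0.5} < y* ≤ P^{0.502}/T`: `… = (500L′Π/log P)(−1 + 𝔶₁ⱼ(y*)) + O(𝓛⁻¹⁵R)`;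
* `eq1010SRel_of_logMean` — `P^{0.502} < y* ≤ P^{0.504}/T`: `… = (500L′Π/log P)(1 + 𝔶₂ⱼ(y*)) + O(𝓛⁻¹⁵R)`,

i.e. clauses 1–3 of L3-t2's SUBSTITUTION READING `Typed.Sec10B.Lemma102S` VERBATIM except for the
factor `R(d,r)` (the relative form, family of G-d43-1 / `Skeleton.Lemma84Rel`). Also here: the size
facts `Dt₀ ≤ P^{0.004}` (`𝓛 ≥ 5`), `y ≤ y* ≤ yP^{0.004}`.

WHAT THIS IS NOT: a proof of `hA`, of Lemma 10.2, of its shifted twin outright, or of anything about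
Theorems 1–2 / Landau–Siegel zeros.

## References

* Y. Zhang, arXiv:2211.02515v1 (2022), §10 Lemma 10.2 (pp. 55–56), Remark p. 57, pp. 60–61;
  §8 Lemma 8.4. [cite: Zhang2022LandauSiegel, §10 Remark p. 57]
-/

noncomputable section

open Complex Real

namespace Literature.NumberTheory.LFunctions.Zhang2022.Lemma102

open Literature.NumberTheory.LFunctions.Zhang2022.Skeleton
open Literature.NumberTheory.LFunctions.Zhang2022.Typed.Sec10B
open Literature.NumberTheory.LFunctions.Zhang2022.Lemma101 (ftilde_log_eq)

variable {c' : ℝ}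

/-! ### Size facts for the shift `y ↦ y* = yP^{0.004}/(Dt₀)` -/

/-- `𝓛 ≥ 5 ⇒ D ≥ 2`. [folklore] -/
private theorem two_le_of_five_le_ell {D : ℕ} (hℓ : 5 ≤ ell D) : 2 ≤ D := by
  by_contra h
  have h2 : D < 2 := not_le.mp h
  interval_cases D
  · simp [ell] at hℓ; linarith
  · simp [ell] at hℓ; linarith

/-- `1 ≤ Dt₀` once `𝓛 ≥ 1` (`t₀ = 𝓛⁵¹⁹`). [cite: Zhang2022LandauSiegel, §2 (2.30)] -/
theorem one_le_Dt0 {D : ℕ} (hℓ : 1 ≤ ell D) : 1 ≤ (D : ℝ) * t0 D := by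
  have hD : (1 : ℝ) ≤ D := by
    have h0 : 0 < ell D := by linarith
    rw [ell] at h0
    have : (1 : ℝ) < D := by
      by_contra h
      have : Real.log (D : ℝ) ≤ 0 := Real.log_nonpos (Nat.cast_nonneg _) (not_lt.mp h)
      linarith
    exact this.le
  have ht : 1 ≤ t0 D := by rw [t0]; exact one_le_pow₀ hℓ
  nlinarith

/-- **`Dt₀ ≤ P^{0.004}`** for `𝓛 ≥ 5`: `log(Dt₀) = 𝓛 + 519 log 𝓛 ≤ 520𝓛 ≤ 0.004𝓛⁹`.
[cite: Zhang2022LandauSiegel, §2 (2.6), (2.30)] -/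
theorem Dt0_le_rpow004 {D : ℕ} (hℓ : 5 ≤ ell D) : (D : ℝ) * t0 D ≤ bigP D ^ (0.004 : ℝ) := by
  have hD2 := two_le_of_five_le_ell hℓ
  have hD0 : (0 : ℝ) < D := by exact_mod_cast (by omega : 0 < D)
  have hℓ0 : 0 < ell D := by linarith
  have hDexp : (D : ℝ) = Real.exp (ell D) := by rw [ell, Real.exp_log hD0]
  have ht0 : t0 D = Real.exp (519 * Real.log (ell D)) := by
    rw [t0, ← Real.exp_log (pow_pos hℓ0 519), Real.log_pow]; norm_num
  have hlogℓ : Real.log (ell D) ≤ ell D - 1 := Real.log_le_sub_one_of_pos hℓ0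
  have hP : bigP D ^ (0.004 : ℝ) = Real.exp (0.004 * ell D ^ 9) := by
    rw [bigP, ← Real.exp_mul]; ring_nf
  rw [hDexp, ht0, ← Real.exp_add, hP, Real.exp_le_exp]
  have h8 : (390625 : ℝ) ≤ ell D ^ 8 := by
    calc (390625 : ℝ) = 5 ^ 8 := by norm_num
      _ ≤ ell D ^ 8 := pow_le_pow_left₀ (by norm_num) hℓ 8
  nlinarith [mul_le_mul_of_nonneg_left h8 hℓ0.le]

/-- `y ≤ y*` for `y ≥ 0` once `𝓛 ≥ 5` (`Dt₀ ≤ P^{0.004}`). [cite: Zhang2022LandauSiegel, §10 p. 57] -/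
theorem le_yShift {D : ℕ} (hℓ : 5 ≤ ell D) {y : ℝ} (hy : 0 ≤ y) : y ≤ yShift D y := by
  have hDt1 : 1 ≤ (D : ℝ) * t0 D := one_le_Dt0 (by linarith)
  have hDt : 0 < (D : ℝ) * t0 D := by linarith
  rw [yShift, le_div_iff₀ hDt]
  exact mul_le_mul_of_nonneg_left (Dt0_le_rpow004 hℓ) hy

/-- `y* ≤ yP^{0.004}` for `y ≥ 0` once `𝓛 ≥ 1` (`Dt₀ ≥ 1`). [cite: Zhang2022LandauSiegel, §10 p. 57] -/
theorem yShift_le {D : ℕ} (hℓ : 1 ≤ ell D) {y : ℝ} (hy : 0 ≤ y) :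
    yShift D y ≤ y * bigP D ^ (0.004 : ℝ) := by
  have hDt1 : 1 ≤ (D : ℝ) * t0 D := one_le_Dt0 hℓ
  rw [yShift]
  exact div_le_self (mul_nonneg hy (Real.rpow_nonneg (Real.exp_pos _).le _)) hDt1

/-- `(yn)* = y*·n`. [cite: Zhang2022LandauSiegel, §10 p. 57] -/
theorem yShift_mul (D : ℕ) (y n : ℝ) : yShift D (y * n) = yShift D y * n := by
  unfold yShift; ring

/-! ### The shifted tent decomposition -/

/-- **The shifted `𝔳₂ⱼ`-sum as three untwisted log-means** (Remark p. 57 + (10.6)): for `d, r ≥ 1`,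
`P > 1`, `D ≥ 2` and `y* = drP^{0.004}/(Dt₀) ≥ 1`,
`frakv2S = (500/log P)(A(P^{0.504}/y*) − 2A(P^{0.502}/y*) + A(P^{0.5}/y*))`,
`A(X) = Σ_{n≤X} χ(n)ξ₀ⱼ(n;d,r)n⁻¹log(X/n)`. [cite: Zhang2022LandauSiegel, §10 Remark p. 57, (10.6)] -/
theorem frakv2S_eq_logMeans {D : ℕ} [NeZero D] (χ : DirichletCharacter ℂ D) (c' : ℝ) (j : ℕ)
    {d r : ℕ} (hd : 1 ≤ d) (hr : 1 ≤ r) (hP : 1 < bigP D) (hD : 2 ≤ D)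
    (hys : 1 ≤ yShift D ((d * r : ℕ) : ℝ)) :
    frakv2S c' χ j d r = ((500 / Real.log (bigP D) : ℝ) : ℂ) *
      ((∑ n ∈ Finset.Ioc 0 ⌊bigP D ^ (0.504 : ℝ) / yShift D ((d * r : ℕ) : ℝ)⌋₊,
          χ (n : ZMod D) * xiZero c' D j n d r / (n : ℂ) *
            (Real.log (bigP D ^ (0.504 : ℝ) / yShift D ((d * r : ℕ) : ℝ) / n) : ℂ)) -
        2 * (∑ n ∈ Finset.Ioc 0 ⌊bigP D ^ (0.502 : ℝ) / yShift D ((d * r : ℕ) : ℝ)⌋₊,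
          χ (n : ZMod D) * xiZero c' D j n d r / (n : ℂ) *
            (Real.log (bigP D ^ (0.502 : ℝ) / yShift D ((d * r : ℕ) : ℝ) / n) : ℂ)) +
        (∑ n ∈ Finset.Ioc 0 ⌊bigP D ^ (0.5 : ℝ) / yShift D ((d * r : ℕ) : ℝ)⌋₊,
          χ (n : ZMod D) * xiZero c' D j n d r / (n : ℂ) *
            (Real.log (bigP D ^ (0.5 : ℝ) / yShift D ((d * r : ℕ) : ℝ) / n) : ℂ))) := by
  have hP0 : 0 < bigP D := by linarith
  set P : ℝ := bigP D with hPdef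
  set ys : ℝ := yShift D ((d * r : ℕ) : ℝ) with hysdef
  have hy0 : 0 < ((d * r : ℕ) : ℝ) := by
    have : 1 ≤ d * r := Nat.one_le_iff_ne_zero.mpr (Nat.mul_ne_zero (by omega) (by omega))
    exact_mod_cast this
  have hys0 : 0 < ys := by linarith
  set w : ℕ → ℂ := fun n => χ (n : ZMod D) * xiZero c' D j n d r / (n : ℂ) with hw
  have hXpos : ∀ a : ℝ, 0 < P ^ a / ys := fun a => by positivity
  have hXQ : ∀ a : ℝ, a ≤ 1 → P ^ a / ys ≤ (⌈P⌉₊ : ℕ) := by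
    intro a ha
    calc P ^ a / ys ≤ P ^ a := div_le_self (by positivity) hys
      _ ≤ P ^ (1 : ℝ) := Real.rpow_le_rpow_of_exponent_le hP.le ha
      _ = P := Real.rpow_one P
      _ ≤ (⌈P⌉₊ : ℕ) := Nat.le_ceil P
  have hterm : ∀ n ∈ Finset.Ico 1 ⌈P⌉₊,
      χ (n : ZMod D) *
          (ftilde (Real.log ((d * r * n : ℕ) : ℝ) / Real.log P + 0.004 - alphaTilde D) : ℂ) *
          xiZero c' D j n d r / (n : ℂ) =
        ((500 / Real.log P : ℝ) : ℂ) *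
          (w n * ((max (Real.log (P ^ (0.504 : ℝ) / ys / n)) 0 : ℝ) : ℂ) -
            2 * (w n * ((max (Real.log (P ^ (0.502 : ℝ) / ys / n)) 0 : ℝ) : ℂ)) +
            w n * ((max (Real.log (P ^ (0.5 : ℝ) / ys / n)) 0 : ℝ) : ℂ)) := by
    intro n hn
    rw [Finset.mem_Ico] at hn
    have hn0 : (0 : ℝ) < n := by exact_mod_cast hn.1
    have hcast : ((d * r * n : ℕ) : ℝ) = ((d * r : ℕ) : ℝ) * n := by push_cast; ring
    have hv : 0 < ((d * r : ℕ) : ℝ) * n := mul_pos hy0 hn0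
    rw [hcast, hPdef, shiftArg_eq hD hv, yShift_mul, ← hysdef, ← hPdef,
      ftilde_log_eq hP hys0 hn0, hw]
    push_cast
    ring
  rw [frakv2S, Finset.sum_congr rfl hterm, ← Finset.mul_sum, Finset.sum_add_distrib,
    Finset.sum_sub_distrib, ← Finset.mul_sum,
    sum_ramp_eq' w (hXpos _) (hXQ _ (by norm_num)),
    sum_ramp_eq' w (hXpos _) (hXQ _ (by norm_num)),
    sum_ramp_eq' w (hXpos _) (hXQ _ (by norm_num))]

/-! ### Pointwise consequences of a log-mean estimate at one modulus -/

section Pointwise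

variable {D : ℕ} [NeZero D] (χ : DirichletCharacter ℂ D) (c' : ℝ) (j : ℕ) {d r : ℕ}

/-- Range algebra: `y* ≤ P^a/T` gives `T ≤ P^a/y*` (`y* > 0`, `T > 0`). [folklore] -/
private theorem T_le_div_of_le_div {T Q ys : ℝ} (hT : 0 < T) (hys : 0 < ys) (h : ys ≤ Q / T) :
    T ≤ Q / ys := by
  rw [le_div_iff₀ hys]
  rw [le_div_iff₀ hT] at h
  linarith [mul_comm T ys]

/-- `P^b/y* ≤ P` for `b ≤ 1`, `y* ≥ 1`, `P ≥ 1`. [folklore] -/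
private theorem rpow_div_le_self {P ys b : ℝ} (hP : 1 ≤ P) (hys : 1 ≤ ys) (hb : b ≤ 1) :
    P ^ b / ys ≤ P := by
  have hP0 : 0 < P := by linarith
  calc P ^ b / ys ≤ P ^ b := div_le_self (by positivity) hys
    _ ≤ P ^ (1 : ℝ) := Real.rpow_le_rpow_of_exponent_le hP hb
    _ = P := Real.rpow_one P

/-- **Shifted (10.8), pointwise**: if the log-mean estimate holds at the modulus `D` for `(j,d,r)`
with tolerance `E` on `T ≤ x ≤ P`, and `1 ≤ y* ≤ P^{0.5}/T`, then
`‖frakv2S − (L′(1,χ)Π(d,r)/500)β_{j+1}β_{j+2}log P‖ ≤ 2000E/log P`.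
[cite: Zhang2022LandauSiegel, §10 (10.8), Remark p. 57] -/
theorem frakv2S_low_of_key (hd : 1 ≤ d) (hr : 1 ≤ r) (hP : 1 < bigP D) (hD : 2 ≤ D) {E : ℝ}
    (hkey : ∀ x : ℝ, bigT D ≤ x → x ≤ bigP D →
      ‖(∑ n ∈ Finset.Ioc 0 ⌊x⌋₊, χ (n : ZMod D) * xiZero c' D j n d r / (n : ℂ) *
            (Real.log (x / n) : ℂ)) -
          deriv χ.LFunction 1 * PiW χ d r *
            (1 + (betaJ c' D (j + 1) + betaJ c' D (j + 2)) * (Real.log x : ℂ) +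
              betaJ c' D (j + 1) * betaJ c' D (j + 2) * (Real.log x : ℂ) ^ 2 / 2)‖ ≤ E)
    (hys1 : 1 ≤ yShift D ((d * r : ℕ) : ℝ))
    (hys : yShift D ((d * r : ℕ) : ℝ) ≤ bigP D ^ (0.5 : ℝ) / bigT D) :
    ‖frakv2S c' χ j d r - deriv χ.LFunction 1 * PiW χ d r / 500 *
        (betaJ c' D (j + 1) * betaJ c' D (j + 2)) * Real.log (bigP D)‖ ≤
      2000 * E / Real.log (bigP D) := by
  have hP0 : 0 < bigP D := by linarith
  have hT : 0 < bigT D := Real.exp_pos _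
  set ys : ℝ := yShift D ((d * r : ℕ) : ℝ) with hysdef
  have hys0 : 0 < ys := by linarith
  rw [frakv2S_eq_logMeans χ c' j hd hr hP hD hys1]
  -- the three means
  have hX3 : bigT D ≤ bigP D ^ (0.5 : ℝ) / ys := T_le_div_of_le_div hT hys0 hys
  have hX1 : bigT D ≤ bigP D ^ (0.504 : ℝ) / ys := by
    refine hX3.trans ?_; gcongr; exact hP.le; norm_num
  have hX2 : bigT D ≤ bigP D ^ (0.502 : ℝ) / ys := by
    refine hX3.trans ?_; gcongr; exact hP.le; norm_num
  have e1 := hkey _ hX1 (rpow_div_le_self hP.le hys1 (by norm_num))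
  have e2 := hkey _ hX2 (rpow_div_le_self hP.le hys1 (by norm_num))
  have e3 := hkey _ hX3 (rpow_div_le_self hP.le hys1 (by norm_num))
  have hE0 : 0 ≤ E := (norm_nonneg _).trans e1
  -- abbreviations
  set M : ℂ := deriv χ.LFunction 1 * PiW χ d r with hM
  set βa : ℂ := betaJ c' D (j + 1)
  set βb : ℂ := betaJ c' D (j + 2)
  set A1 := ∑ n ∈ Finset.Ioc 0 ⌊bigP D ^ (0.504 : ℝ) / ys⌋₊,
    χ (n : ZMod D) * xiZero c' D j n d r / (n : ℂ) * (Real.log (bigP D ^ (0.504 : ℝ) / ys / n) : ℂ)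
  set A2 := ∑ n ∈ Finset.Ioc 0 ⌊bigP D ^ (0.502 : ℝ) / ys⌋₊,
    χ (n : ZMod D) * xiZero c' D j n d r / (n : ℂ) * (Real.log (bigP D ^ (0.502 : ℝ) / ys / n) : ℂ)
  set A3 := ∑ n ∈ Finset.Ioc 0 ⌊bigP D ^ (0.5 : ℝ) / ys⌋₊,
    χ (n : ZMod D) * xiZero c' D j n d r / (n : ℂ) * (Real.log (bigP D ^ (0.5 : ℝ) / ys / n) : ℂ)
  set m1 := M * (1 + (βa + βb) * (Real.log (bigP D ^ (0.504 : ℝ) / ys) : ℂ) +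
    βa * βb * (Real.log (bigP D ^ (0.504 : ℝ) / ys) : ℂ) ^ 2 / 2)
  set m2 := M * (1 + (βa + βb) * (Real.log (bigP D ^ (0.502 : ℝ) / ys) : ℂ) +
    βa * βb * (Real.log (bigP D ^ (0.502 : ℝ) / ys) : ℂ) ^ 2 / 2)
  set m3 := M * (1 + (βa + βb) * (Real.log (bigP D ^ (0.5 : ℝ) / ys) : ℂ) +
    βa * βb * (Real.log (bigP D ^ (0.5 : ℝ) / ys) : ℂ) ^ 2 / 2)
  have hcomb : m1 - 2 * m2 + m3 = M * (βa * βb * (((Real.log (bigP D) / 500) ^ 2 : ℝ) : ℂ)) := by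
    simp only [m1, m2, m3]
    rw [← resComb_three hP0 hys0 βa βb]
    ring
  have hΛpos : 0 < Real.log (bigP D) := Real.log_pos hP
  have hΛ : (Real.log (bigP D) : ℂ) ≠ 0 := by exact_mod_cast hΛpos.ne'
  have hv : ((500 / Real.log (bigP D) : ℝ) : ℂ) * (A1 - 2 * A2 + A3) -
      M / 500 * (βa * βb) * Real.log (bigP D) =
      ((500 / Real.log (bigP D) : ℝ) : ℂ) * ((A1 - m1) - 2 * (A2 - m2) + (A3 - m3)) := by
    have : ((500 / Real.log (bigP D) : ℝ) : ℂ) * ((A1 - m1) - 2 * (A2 - m2) + (A3 - m3)) =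
        ((500 / Real.log (bigP D) : ℝ) : ℂ) * (A1 - 2 * A2 + A3) -
          ((500 / Real.log (bigP D) : ℝ) : ℂ) * (m1 - 2 * m2 + m3) := by ring
    rw [this, hcomb]
    push_cast
    field_simp
  rw [show deriv χ.LFunction 1 * PiW χ d r / 500 * (betaJ c' D (j + 1) * betaJ c' D (j + 2)) *
      (Real.log (bigP D) : ℂ) = M / 500 * (βa * βb) * Real.log (bigP D) by rw [hM], hv]
  have hpre : ‖((500 / Real.log (bigP D) : ℝ) : ℂ)‖ = 500 / Real.log (bigP D) := by
    rw [Complex.norm_real, Real.norm_of_nonneg (by positivity)]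
  calc ‖((500 / Real.log (bigP D) : ℝ) : ℂ) * ((A1 - m1) - 2 * (A2 - m2) + (A3 - m3))‖
      = 500 / Real.log (bigP D) * ‖(A1 - m1) - 2 * (A2 - m2) + (A3 - m3)‖ := by
        rw [norm_mul, hpre]
    _ ≤ 500 / Real.log (bigP D) * (‖A1 - m1‖ + 2 * ‖A2 - m2‖ + ‖A3 - m3‖) := by
        gcongr
        calc ‖(A1 - m1) - 2 * (A2 - m2) + (A3 - m3)‖
            ≤ ‖(A1 - m1) - 2 * (A2 - m2)‖ + ‖A3 - m3‖ := norm_add_le _ _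
          _ ≤ ‖A1 - m1‖ + ‖2 * (A2 - m2)‖ + ‖A3 - m3‖ := by gcongr; exact norm_sub_le _ _
          _ = ‖A1 - m1‖ + 2 * ‖A2 - m2‖ + ‖A3 - m3‖ := by rw [norm_mul, Complex.norm_two]
    _ ≤ 500 / Real.log (bigP D) * (4 * E) := by gcongr; linarith
    _ = 2000 * E / Real.log (bigP D) := by ring

/-- **Shifted (10.9), pointwise**: with the log-mean estimate (tolerance `E`) at the modulus `D` for
`(j,d,r)`, and `P^{0.5} < y* ≤ P^{0.502}/T` (so `y* ≥ 1`),
`‖frakv2S − (500L′(1,χ)Π(d,r)/log P)(−1 + 𝔶₁ⱼ(y*))‖ ≤ 1500E/log P` (the mean at `P^{0.5}/y* < 1` is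
empty). [cite: Zhang2022LandauSiegel, §10 (10.9), Remark p. 57] -/
theorem frakv2S_mid_of_key (hd : 1 ≤ d) (hr : 1 ≤ r) (hP : 1 < bigP D) (hD : 2 ≤ D) {E : ℝ}
    (hkey : ∀ x : ℝ, bigT D ≤ x → x ≤ bigP D →
      ‖(∑ n ∈ Finset.Ioc 0 ⌊x⌋₊, χ (n : ZMod D) * xiZero c' D j n d r / (n : ℂ) *
            (Real.log (x / n) : ℂ)) -
          deriv χ.LFunction 1 * PiW χ d r *
            (1 + (betaJ c' D (j + 1) + betaJ c' D (j + 2)) * (Real.log x : ℂ) +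
              betaJ c' D (j + 1) * betaJ c' D (j + 2) * (Real.log x : ℂ) ^ 2 / 2)‖ ≤ E)
    (hlo : bigP D ^ (0.5 : ℝ) < yShift D ((d * r : ℕ) : ℝ))
    (hys : yShift D ((d * r : ℕ) : ℝ) ≤ bigP D ^ (0.502 : ℝ) / bigT D) :
    ‖frakv2S c' χ j d r - 500 * deriv χ.LFunction 1 * PiW χ d r / Real.log (bigP D) *
        (-1 + fraky1 c' D j (yShift D ((d * r : ℕ) : ℝ)))‖ ≤ 1500 * E / Real.log (bigP D) := by
  have hP0 : 0 < bigP D := by linarith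
  have hT : 0 < bigT D := Real.exp_pos _
  set ys : ℝ := yShift D ((d * r : ℕ) : ℝ) with hysdef
  have hys1 : 1 ≤ ys := (Real.one_le_rpow hP.le (by norm_num : (0:ℝ) ≤ 0.5)).trans hlo.le
  have hys0 : 0 < ys := by linarith
  rw [frakv2S_eq_logMeans χ c' j hd hr hP hD hys1]
  have hX2 : bigT D ≤ bigP D ^ (0.502 : ℝ) / ys := T_le_div_of_le_div hT hys0 hys
  have hX1 : bigT D ≤ bigP D ^ (0.504 : ℝ) / ys := by
    refine hX2.trans ?_; gcongr; exact hP.le; norm_num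
  have e1 := hkey _ hX1 (rpow_div_le_self hP.le hys1 (by norm_num))
  have e2 := hkey _ hX2 (rpow_div_le_self hP.le hys1 (by norm_num))
  have hE0 : 0 ≤ E := (norm_nonneg _).trans e1
  -- the empty mean
  have hX3 : bigP D ^ (0.5 : ℝ) / ys < 1 := by rwa [div_lt_one hys0]
  have hA3 : ∑ n ∈ Finset.Ioc 0 ⌊bigP D ^ (0.5 : ℝ) / ys⌋₊,
      χ (n : ZMod D) * xiZero c' D j n d r / (n : ℂ) *
        (Real.log (bigP D ^ (0.5 : ℝ) / ys / n) : ℂ) = 0 :=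
    logMean_eq_zero_of_lt_one _ hX3
  set M : ℂ := deriv χ.LFunction 1 * PiW χ d r with hM
  set βa : ℂ := betaJ c' D (j + 1)
  set βb : ℂ := betaJ c' D (j + 2)
  set A1 := ∑ n ∈ Finset.Ioc 0 ⌊bigP D ^ (0.504 : ℝ) / ys⌋₊,
    χ (n : ZMod D) * xiZero c' D j n d r / (n : ℂ) * (Real.log (bigP D ^ (0.504 : ℝ) / ys / n) : ℂ)
  set A2 := ∑ n ∈ Finset.Ioc 0 ⌊bigP D ^ (0.502 : ℝ) / ys⌋₊,
    χ (n : ZMod D) * xiZero c' D j n d r / (n : ℂ) * (Real.log (bigP D ^ (0.502 : ℝ) / ys / n) : ℂ)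
  set m1 := M * (1 + (βa + βb) * (Real.log (bigP D ^ (0.504 : ℝ) / ys) : ℂ) +
    βa * βb * (Real.log (bigP D ^ (0.504 : ℝ) / ys) : ℂ) ^ 2 / 2)
  set m2 := M * (1 + (βa + βb) * (Real.log (bigP D ^ (0.502 : ℝ) / ys) : ℂ) +
    βa * βb * (Real.log (bigP D ^ (0.502 : ℝ) / ys) : ℂ) ^ 2 / 2)
  have hcomb : m1 - 2 * m2 = M * (-1 + fraky1 c' D j ys) := by
    simp only [m1, m2]
    rw [← resComb_two c' D j hys0]
    ring
  have hΛpos : 0 < Real.log (bigP D) := Real.log_pos hP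
  have hΛ : (Real.log (bigP D) : ℂ) ≠ 0 := by exact_mod_cast hΛpos.ne'
  rw [hA3]
  have hv : ((500 / Real.log (bigP D) : ℝ) : ℂ) * (A1 - 2 * A2 + 0) -
      500 * M / Real.log (bigP D) * (-1 + fraky1 c' D j ys) =
      ((500 / Real.log (bigP D) : ℝ) : ℂ) * ((A1 - m1) - 2 * (A2 - m2)) := by
    have : ((500 / Real.log (bigP D) : ℝ) : ℂ) * ((A1 - m1) - 2 * (A2 - m2)) =
        ((500 / Real.log (bigP D) : ℝ) : ℂ) * (A1 - 2 * A2 + 0) -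
          ((500 / Real.log (bigP D) : ℝ) : ℂ) * (m1 - 2 * m2) := by ring
    rw [this, hcomb]
    push_cast
    field_simp
  rw [show 500 * deriv χ.LFunction 1 * PiW χ d r / (Real.log (bigP D) : ℂ) *
      (-1 + fraky1 c' D j ys) = 500 * M / Real.log (bigP D) * (-1 + fraky1 c' D j ys) by
      rw [hM]; ring, hv]
  have hpre : ‖((500 / Real.log (bigP D) : ℝ) : ℂ)‖ = 500 / Real.log (bigP D) := by
    rw [Complex.norm_real, Real.norm_of_nonneg (by positivity)]
  calc ‖((500 / Real.log (bigP D) : ℝ) : ℂ) * ((A1 - m1) - 2 * (A2 - m2))‖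
      = 500 / Real.log (bigP D) * ‖(A1 - m1) - 2 * (A2 - m2)‖ := by rw [norm_mul, hpre]
    _ ≤ 500 / Real.log (bigP D) * (‖A1 - m1‖ + 2 * ‖A2 - m2‖) := by
        gcongr
        calc ‖(A1 - m1) - 2 * (A2 - m2)‖ ≤ ‖A1 - m1‖ + ‖2 * (A2 - m2)‖ := norm_sub_le _ _
          _ = ‖A1 - m1‖ + 2 * ‖A2 - m2‖ := by rw [norm_mul, Complex.norm_two]
    _ ≤ 500 / Real.log (bigP D) * (3 * E) := by gcongr; linarith
    _ = 1500 * E / Real.log (bigP D) := by ring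

/-- **Shifted (10.10), pointwise**: with the log-mean estimate (tolerance `E`) at the modulus `D` for
`(j,d,r)`, and `P^{0.502} < y* ≤ P^{0.504}/T`,
`‖frakv2S − (500L′(1,χ)Π(d,r)/log P)(1 + 𝔶₂ⱼ(y*))‖ ≤ 500E/log P` (two means empty).
[cite: Zhang2022LandauSiegel, §10 (10.10), Remark p. 57] -/
theorem frakv2S_top_of_key (hd : 1 ≤ d) (hr : 1 ≤ r) (hP : 1 < bigP D) (hD : 2 ≤ D) {E : ℝ}
    (hkey : ∀ x : ℝ, bigT D ≤ x → x ≤ bigP D →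
      ‖(∑ n ∈ Finset.Ioc 0 ⌊x⌋₊, χ (n : ZMod D) * xiZero c' D j n d r / (n : ℂ) *
            (Real.log (x / n) : ℂ)) -
          deriv χ.LFunction 1 * PiW χ d r *
            (1 + (betaJ c' D (j + 1) + betaJ c' D (j + 2)) * (Real.log x : ℂ) +
              betaJ c' D (j + 1) * betaJ c' D (j + 2) * (Real.log x : ℂ) ^ 2 / 2)‖ ≤ E)
    (hlo : bigP D ^ (0.502 : ℝ) < yShift D ((d * r : ℕ) : ℝ))
    (hys : yShift D ((d * r : ℕ) : ℝ) ≤ bigP D ^ (0.504 : ℝ) / bigT D) :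
    ‖frakv2S c' χ j d r - 500 * deriv χ.LFunction 1 * PiW χ d r / Real.log (bigP D) *
        (1 + fraky2 c' D j (yShift D ((d * r : ℕ) : ℝ)))‖ ≤ 500 * E / Real.log (bigP D) := by
  have hP0 : 0 < bigP D := by linarith
  have hT : 0 < bigT D := Real.exp_pos _
  set ys : ℝ := yShift D ((d * r : ℕ) : ℝ) with hysdef
  have h502 : 1 ≤ bigP D ^ (0.502 : ℝ) := Real.one_le_rpow hP.le (by norm_num)
  have hys1 : 1 ≤ ys := h502.trans hlo.le
  have hys0 : 0 < ys := by linarith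
  rw [frakv2S_eq_logMeans χ c' j hd hr hP hD hys1]
  have hX1 : bigT D ≤ bigP D ^ (0.504 : ℝ) / ys := T_le_div_of_le_div hT hys0 hys
  have e1 := hkey _ hX1 (rpow_div_le_self hP.le hys1 (by norm_num))
  have hE0 : 0 ≤ E := (norm_nonneg _).trans e1
  -- the empty means
  have h5lt : bigP D ^ (0.5 : ℝ) < ys := by
    refine lt_of_le_of_lt ?_ hlo
    exact Real.rpow_le_rpow_of_exponent_le hP.le (by norm_num)
  have hX3 : bigP D ^ (0.5 : ℝ) / ys < 1 := by rwa [div_lt_one hys0]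
  have hX2 : bigP D ^ (0.502 : ℝ) / ys < 1 := by rwa [div_lt_one hys0]
  have hA3 : ∑ n ∈ Finset.Ioc 0 ⌊bigP D ^ (0.5 : ℝ) / ys⌋₊,
      χ (n : ZMod D) * xiZero c' D j n d r / (n : ℂ) *
        (Real.log (bigP D ^ (0.5 : ℝ) / ys / n) : ℂ) = 0 :=
    logMean_eq_zero_of_lt_one _ hX3
  have hA2 : ∑ n ∈ Finset.Ioc 0 ⌊bigP D ^ (0.502 : ℝ) / ys⌋₊,
      χ (n : ZMod D) * xiZero c' D j n d r / (n : ℂ) *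
        (Real.log (bigP D ^ (0.502 : ℝ) / ys / n) : ℂ) = 0 :=
    logMean_eq_zero_of_lt_one _ hX2
  set M : ℂ := deriv χ.LFunction 1 * PiW χ d r with hM
  set βa : ℂ := betaJ c' D (j + 1)
  set βb : ℂ := betaJ c' D (j + 2)
  set A1 := ∑ n ∈ Finset.Ioc 0 ⌊bigP D ^ (0.504 : ℝ) / ys⌋₊,
    χ (n : ZMod D) * xiZero c' D j n d r / (n : ℂ) * (Real.log (bigP D ^ (0.504 : ℝ) / ys / n) : ℂ)
  set m1 := M * (1 + (βa + βb) * (Real.log (bigP D ^ (0.504 : ℝ) / ys) : ℂ) +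
    βa * βb * (Real.log (bigP D ^ (0.504 : ℝ) / ys) : ℂ) ^ 2 / 2)
  have hcomb : m1 = M * (1 + fraky2 c' D j ys) := by
    simp only [m1]
    rw [← resComb_one c' D j ys]
  have hΛpos : 0 < Real.log (bigP D) := Real.log_pos hP
  have hΛ : (Real.log (bigP D) : ℂ) ≠ 0 := by exact_mod_cast hΛpos.ne'
  rw [hA3, hA2]
  have hv : ((500 / Real.log (bigP D) : ℝ) : ℂ) * (A1 - 2 * 0 + 0) -
      500 * M / Real.log (bigP D) * (1 + fraky2 c' D j ys) =
      ((500 / Real.log (bigP D) : ℝ) : ℂ) * (A1 - m1) := by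
    rw [mul_sub, hcomb]
    push_cast
    field_simp
    ring
  rw [show 500 * deriv χ.LFunction 1 * PiW χ d r / (Real.log (bigP D) : ℂ) *
      (1 + fraky2 c' D j ys) = 500 * M / Real.log (bigP D) * (1 + fraky2 c' D j ys) by
      rw [hM]; ring, hv]
  have hpre : ‖((500 / Real.log (bigP D) : ℝ) : ℂ)‖ = 500 / Real.log (bigP D) := by
    rw [Complex.norm_real, Real.norm_of_nonneg (by positivity)]
  rw [norm_mul, hpre]
  calc 500 / Real.log (bigP D) * ‖A1 - m1‖ ≤ 500 / Real.log (bigP D) * E := by gcongr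
    _ = 500 * E / Real.log (bigP D) := by ring

end Pointwise


/-! ### The shifted (10.8)–(10.10) in relative form, for all large `D`, from the log-mean estimate -/

section Packaged

/-- Threshold: `D ≥ ⌈e⁵⌉ ⇒ 𝓛 ≥ 5`. [folklore] -/
private theorem five_le_ell {D : ℕ} (hD : ⌈Real.exp 5⌉₊ ≤ D) : 5 ≤ ell D := by
  have h1 : Real.exp 5 ≤ (D : ℝ) := le_trans (Nat.le_ceil _) (by exact_mod_cast hD)
  have h2 := Real.log_le_log (Real.exp_pos _) h1
  rwa [Real.log_exp] at h2

/-- The common largeness facts at `𝓛 ≥ 5`: `D ≥ 2`, `2 ≤ log D`, `P > 1`, and for `d, r ≥ 1`: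
`1 ≤ dr ≤ y*`, and `y* ≤ P^{0.504}/T ⇒ dr < PT⁻²`. [cite: Zhang2022LandauSiegel, §10 Remark p. 57] -/
private theorem large_facts {D d r : ℕ} (hℓ : 5 ≤ ell D) (hd : 1 ≤ d) (hr : 1 ≤ r) :
    2 ≤ D ∧ 2 ≤ Real.log D ∧ 1 < bigP D ∧ 1 ≤ yShift D ((d * r : ℕ) : ℝ) ∧
      (yShift D ((d * r : ℕ) : ℝ) ≤ bigP D ^ (0.504 : ℝ) / bigT D →
        ((d * r : ℕ) : ℝ) < bigP D / bigT D ^ 2) := by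
  have hD2 := two_le_of_five_le_ell hℓ
  have hlog : 2 ≤ Real.log D := by
    have h2 : (2 : ℝ) ≤ ell D := by linarith
    rw [ell] at h2
    exact h2
  have hℓ0 : 0 < ell D := by linarith
  have hP1 : 1 < bigP D := by rw [bigP]; exact Real.one_lt_exp_iff.mpr (pow_pos hℓ0 9)
  have hy1 : (1 : ℝ) ≤ ((d * r : ℕ) : ℝ) := by
    have : 1 ≤ d * r := Nat.one_le_iff_ne_zero.mpr (Nat.mul_ne_zero (by omega) (by omega))
    exact_mod_cast this
  have hys : ((d * r : ℕ) : ℝ) ≤ yShift D ((d * r : ℕ) : ℝ) := le_yShift hℓ (by linarith)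
  refine ⟨hD2, hlog, hP1, hy1.trans hys, fun h => ?_⟩
  have hT1 : 1 ≤ bigT D := Real.one_le_exp (by positivity)
  have h2 : bigP D ^ (0.504 : ℝ) / bigT D ≤ bigP D ^ (0.504 : ℝ) :=
    div_le_self (by positivity) hT1
  have h3 : bigP D ^ (0.504 : ℝ) < bigP D / bigT D ^ 2 := P1_lt_P_div_T_sq D hlog
  linarith

/-- Tolerance bookkeeping: `k·(Cℓ⁻⁶R)/ℓ⁹ ≤ k·max C 0·ℓ⁻¹⁵·R`. [folklore] -/
private theorem tol_le {k C ℓ R : ℝ} (hk : 0 ≤ k) (hℓ : 0 < ℓ) (hR : 0 ≤ R) :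
    k * (C * (ℓ ^ 6)⁻¹ * R) / ℓ ^ 9 ≤ k * max C 0 * (ℓ ^ 15)⁻¹ * R := by
  have hC : C ≤ max C 0 := le_max_left _ _
  have e : k * (C * (ℓ ^ 6)⁻¹ * R) / ℓ ^ 9 = k * C * (ℓ ^ 15)⁻¹ * R := by
    field_simp
  rw [e]
  have : 0 ≤ k * (ℓ ^ 15)⁻¹ * R := by positivity
  nlinarith

/-- **Shifted (10.8), relative form, from the shift-0 log-mean estimate** (Remark p. 57 applied to
(10.8)): if `y* = drP^{0.004}/(Dt₀) ≤ P^{0.5}/T` then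
`‖frakv2S − (L′(1,χ)Π(d,r)/500)β_{j+1}β_{j+2}log P‖ ≤ C′𝓛⁻¹⁵(∏_{q∣dr}(1−q⁻¹)⁻¹)²`, `C′ = 2000·max C 0` —
clause 1 of `Typed.Sec10B.Lemma102S` up to the factor `R(d,r)`.
[cite: Zhang2022LandauSiegel, §10 (10.8), Remark p. 57] -/
theorem eq108SRel_of_logMean (hA : ∃ C : ℝ, ForAllLarge fun D _ χ => AssumptionA D χ →
      ∀ j ∈ ({1, 2, 3} : Finset ℕ), ∀ d r : ℕ,
          1 ≤ d → 1 ≤ r → ((d * r : ℕ) : ℝ) < bigP D / bigT D ^ 2 → ∀ x : ℝ, bigT D ≤ x → x ≤ bigP D →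
            ‖(∑ n ∈ Finset.Ioc 0 ⌊x⌋₊, χ (n : ZMod D) * xiZero c' D j n d r / (n : ℂ) *
                  (Real.log (x / n) : ℂ)) -
                deriv χ.LFunction 1 * PiW χ d r *
                  (1 + (betaJ c' D (j + 1) + betaJ c' D (j + 2)) * (Real.log x : ℂ) +
                    betaJ c' D (j + 1) * betaJ c' D (j + 2) * (Real.log x : ℂ) ^ 2 / 2)‖ ≤
              C * (ell D ^ 6)⁻¹ * (∏ q ∈ (d * r).primeFactors, (1 - (q : ℝ)⁻¹)⁻¹) ^ 2) :
    ∃ C : ℝ, ForAllLarge fun D _ χ => AssumptionA D χ →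
      ∀ j ∈ ({1, 2, 3} : Finset ℕ), ∀ d r : ℕ, 1 ≤ d → 1 ≤ r →
        yShift D ((d * r : ℕ) : ℝ) ≤ bigP D ^ (0.5 : ℝ) / bigT D →
          ‖frakv2S c' χ j d r - deriv χ.LFunction 1 * PiW χ d r / 500 *
            (betaJ c' D (j + 1) * betaJ c' D (j + 2)) * Real.log (bigP D)‖ ≤
            C * (ell D ^ 15)⁻¹ * (∏ q ∈ (d * r).primeFactors, (1 - (q : ℝ)⁻¹)⁻¹) ^ 2 := by
  obtain ⟨C, D₀, h⟩ := hA
  refine ⟨2000 * max C 0, max D₀ ⌈Real.exp 5⌉₊, fun D _ χ hD hq hp hA' j hj d r hd hr hys => ?_⟩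
  have hD₀ : D₀ ≤ D := le_trans (le_max_left _ _) hD
  have hℓ : 5 ≤ ell D := five_le_ell (le_trans (le_max_right _ _) hD)
  obtain ⟨hD2, -, hP1, hys1, hdrP⟩ := large_facts hℓ hd hr
  have hys' : yShift D ((d * r : ℕ) : ℝ) ≤ bigP D ^ (0.504 : ℝ) / bigT D := by
    refine hys.trans (div_le_div_of_nonneg_right ?_ (Real.exp_pos _).le)
    exact Real.rpow_le_rpow_of_exponent_le hP1.le (by norm_num)
  have key := h D χ hD₀ hq hp hA' j hj d r hd hr (hdrP hys')
  refine (frakv2S_low_of_key χ c' j hd hr hP1 hD2 key hys1 hys).trans ?_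
  have hlogP : Real.log (bigP D) = ell D ^ 9 := by rw [bigP, Real.log_exp]
  rw [hlogP]
  exact tol_le (by norm_num) (by linarith) (by positivity)

/-- **Shifted (10.9), relative form, from the shift-0 log-mean estimate** (Remark p. 57 applied to
(10.9)): if `P^{0.5} < y* ≤ P^{0.502}/T` then
`‖frakv2S − (500L′(1,χ)Π(d,r)/log P)(−1 + 𝔶₁ⱼ(y*))‖ ≤ C′𝓛⁻¹⁵(∏_{q∣dr}(1−q⁻¹)⁻¹)²`, `C′ = 1500·max C 0`
— clause 2 of `Typed.Sec10B.Lemma102S` up to the factor `R(d,r)`.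
[cite: Zhang2022LandauSiegel, §10 (10.9), Remark p. 57] -/
theorem eq109SRel_of_logMean (hA : ∃ C : ℝ, ForAllLarge fun D _ χ => AssumptionA D χ →
      ∀ j ∈ ({1, 2, 3} : Finset ℕ), ∀ d r : ℕ,
          1 ≤ d → 1 ≤ r → ((d * r : ℕ) : ℝ) < bigP D / bigT D ^ 2 → ∀ x : ℝ, bigT D ≤ x → x ≤ bigP D →
            ‖(∑ n ∈ Finset.Ioc 0 ⌊x⌋₊, χ (n : ZMod D) * xiZero c' D j n d r / (n : ℂ) *
                  (Real.log (x / n) : ℂ)) -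
                deriv χ.LFunction 1 * PiW χ d r *
                  (1 + (betaJ c' D (j + 1) + betaJ c' D (j + 2)) * (Real.log x : ℂ) +
                    betaJ c' D (j + 1) * betaJ c' D (j + 2) * (Real.log x : ℂ) ^ 2 / 2)‖ ≤
              C * (ell D ^ 6)⁻¹ * (∏ q ∈ (d * r).primeFactors, (1 - (q : ℝ)⁻¹)⁻¹) ^ 2) :
    ∃ C : ℝ, ForAllLarge fun D _ χ => AssumptionA D χ →
      ∀ j ∈ ({1, 2, 3} : Finset ℕ), ∀ d r : ℕ, 1 ≤ d → 1 ≤ r →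
        bigP D ^ (0.5 : ℝ) < yShift D ((d * r : ℕ) : ℝ) →
        yShift D ((d * r : ℕ) : ℝ) ≤ bigP D ^ (0.502 : ℝ) / bigT D →
          ‖frakv2S c' χ j d r - 500 * deriv χ.LFunction 1 * PiW χ d r / Real.log (bigP D) *
            (-1 + fraky1 c' D j (yShift D ((d * r : ℕ) : ℝ)))‖ ≤
            C * (ell D ^ 15)⁻¹ * (∏ q ∈ (d * r).primeFactors, (1 - (q : ℝ)⁻¹)⁻¹) ^ 2 := by
  obtain ⟨C, D₀, h⟩ := hA
  refine ⟨1500 * max C 0, max D₀ ⌈Real.exp 5⌉₊,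
    fun D _ χ hD hq hp hA' j hj d r hd hr hlo hys => ?_⟩
  have hD₀ : D₀ ≤ D := le_trans (le_max_left _ _) hD
  have hℓ : 5 ≤ ell D := five_le_ell (le_trans (le_max_right _ _) hD)
  obtain ⟨hD2, -, hP1, -, hdrP⟩ := large_facts hℓ hd hr
  have hys' : yShift D ((d * r : ℕ) : ℝ) ≤ bigP D ^ (0.504 : ℝ) / bigT D := by
    refine hys.trans (div_le_div_of_nonneg_right ?_ (Real.exp_pos _).le)
    exact Real.rpow_le_rpow_of_exponent_le hP1.le (by norm_num)
  have key := h D χ hD₀ hq hp hA' j hj d r hd hr (hdrP hys')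
  refine (frakv2S_mid_of_key χ c' j hd hr hP1 hD2 key hlo hys).trans ?_
  have hlogP : Real.log (bigP D) = ell D ^ 9 := by rw [bigP, Real.log_exp]
  rw [hlogP]
  exact tol_le (by norm_num) (by linarith) (by positivity)

/-- **Shifted (10.10), relative form, from the shift-0 log-mean estimate** (Remark p. 57 applied to
(10.10)): if `P^{0.502} < y* ≤ P^{0.504}/T` then
`‖frakv2S − (500L′(1,χ)Π(d,r)/log P)(1 + 𝔶₂ⱼ(y*))‖ ≤ C′𝓛⁻¹⁵(∏_{q∣dr}(1−q⁻¹)⁻¹)²`, `C′ = 500·max C 0`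
— clause 3 of `Typed.Sec10B.Lemma102S` up to the factor `R(d,r)`.
[cite: Zhang2022LandauSiegel, §10 (10.10), Remark p. 57] -/
theorem eq1010SRel_of_logMean (hA : ∃ C : ℝ, ForAllLarge fun D _ χ => AssumptionA D χ →
      ∀ j ∈ ({1, 2, 3} : Finset ℕ), ∀ d r : ℕ,
          1 ≤ d → 1 ≤ r → ((d * r : ℕ) : ℝ) < bigP D / bigT D ^ 2 → ∀ x : ℝ, bigT D ≤ x → x ≤ bigP D →
            ‖(∑ n ∈ Finset.Ioc 0 ⌊x⌋₊, χ (n : ZMod D) * xiZero c' D j n d r / (n : ℂ) *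
                  (Real.log (x / n) : ℂ)) -
                deriv χ.LFunction 1 * PiW χ d r *
                  (1 + (betaJ c' D (j + 1) + betaJ c' D (j + 2)) * (Real.log x : ℂ) +
                    betaJ c' D (j + 1) * betaJ c' D (j + 2) * (Real.log x : ℂ) ^ 2 / 2)‖ ≤
              C * (ell D ^ 6)⁻¹ * (∏ q ∈ (d * r).primeFactors, (1 - (q : ℝ)⁻¹)⁻¹) ^ 2) :
    ∃ C : ℝ, ForAllLarge fun D _ χ => AssumptionA D χ →
      ∀ j ∈ ({1, 2, 3} : Finset ℕ), ∀ d r : ℕ, 1 ≤ d → 1 ≤ r →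
        bigP D ^ (0.502 : ℝ) < yShift D ((d * r : ℕ) : ℝ) →
        yShift D ((d * r : ℕ) : ℝ) ≤ bigP D ^ (0.504 : ℝ) / bigT D →
          ‖frakv2S c' χ j d r - 500 * deriv χ.LFunction 1 * PiW χ d r / Real.log (bigP D) *
            (1 + fraky2 c' D j (yShift D ((d * r : ℕ) : ℝ)))‖ ≤
            C * (ell D ^ 15)⁻¹ * (∏ q ∈ (d * r).primeFactors, (1 - (q : ℝ)⁻¹)⁻¹) ^ 2 := by
  obtain ⟨C, D₀, h⟩ := hA
  refine ⟨500 * max C 0, max D₀ ⌈Real.exp 5⌉₊,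
    fun D _ χ hD hq hp hA' j hj d r hd hr hlo hys => ?_⟩
  have hD₀ : D₀ ≤ D := le_trans (le_max_left _ _) hD
  have hℓ : 5 ≤ ell D := five_le_ell (le_trans (le_max_right _ _) hD)
  obtain ⟨hD2, -, hP1, -, hdrP⟩ := large_facts hℓ hd hr
  have key := h D χ hD₀ hq hp hA' j hj d r hd hr (hdrP hys)
  refine (frakv2S_top_of_key χ c' j hd hr hP1 hD2 key hlo hys).trans ?_
  have hlogP : Real.log (bigP D) = ell D ^ 9 := by rw [bigP, Real.log_exp]
  rw [hlogP]
  exact tol_le (by norm_num) (by linarith) (by positivity)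

end Packaged

end Literature.NumberTheory.LFunctions.Zhang2022.Lemma102
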